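/-
Copyright: pub-rosobs cell (Resolution Observatory), carver gen 39.  Companion file; statements OURS, in
the cell's polynomial weighted-centre model `W(f)`.  Instrument — NOT a resolution theorem.
-/
import Literature.AlgebraicGeometry.Resolution.WeightedCentreUmbrellaPowBound
import Literature.AlgebraicGeometry.Resolution.WeightedCentreSecondFaceSpectators
import HarnessLib

/-!
# `max W(v² + u w² + z^q)` lies on the segment `{(2, 3, 3, c, …) : c ≥ q}`

Book-keeping corollary of the two faces of `f = X_i² + X_j² X_l + X_e^q` (`i, j, l, e` distinct, spectators
allowed, `q ≥ 4` invertible in `k`, ALL polynomial coordinate changes):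

* first face (`WeightedCentreUmbrellaPowBound`): `(2,3,3,q) ∈ W(f)` and nothing in `W(f)` is above `(2,3,3)`;
* second face (`WeightedCentreSecondFaceSpectators`): `(2), (2,3), (2,3,3) ∉ W(f)`;
* here: `[] ∉ W(f)` (`f ≠ 0`), and therefore **every maximal element of `W(f)` has the form
  `(2, 3, 3, c, …)` with `c ≥ q`** (`isMaxInv_umbrellaPow_shape`).  The census value is `(2, 3, 3, q)`; the
  missing inequality `c ≤ q` is NOT proved here.

References: [AbramovichTemkinWlodarczyk2024, Thm. 5.3.1 (2) (p. 1578), §5.1]; [Temkin2025, §1.2.2 (1)].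
Statements ours (the cell's model) — NOT a resolution theorem.
-/

open MvPolynomial

namespace Literature.AlgebraicGeometry.Resolution.WeightedBlowup

variable {k : Type*} [Field k] {N : ℕ}

/-- **`[] ∉ W(f)` for `f ≠ 0`**: the empty invariant would be the zero cocharacter, for which no monomial has
value `≥ 1`. (derived here) [cite: AbramovichTemkinWlodarczyk2024, §5.1 (invariants of centres are non-empty)] -/
theorem nil_not_mem_admissibleInvariants {f : MvPolynomial (Fin N) k} (hf : f ≠ 0) :
    ([] : List ℚ) ∉ admissibleInvariants f := by
  classical
  rintro ⟨Ψ, γ, h, hγ⟩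
  have hγ0 : ∀ x, γ x = 0 := by
    intro x
    by_contra hx
    have hmem : (γ x)⁻¹ ∈ exps γ := by
      unfold exps
      rw [List.mem_insertionSort, List.mem_map]
      exact ⟨x, Finset.mem_toList.2 (Finset.mem_filter.2 ⟨Finset.mem_univ _, hx⟩), rfl⟩
    rw [hγ] at hmem
    simp at hmem
  have hne : Ψ.symm f ≠ 0 := fun h0 => hf (by simpa using congrArg Ψ h0)
  obtain ⟨d, hd⟩ := MvPolynomial.ne_zero_iff.1 hne
  have h1 := h.2.2 d (mem_support_iff.2 hd)
  simp [monomialValuation, hγ0] at h1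
  exact absurd h1 (by norm_num)

variable {i j l e : Fin N} {q : ℕ}

/-- The two names of the germ agree (plumbing). [cite: Temkin2025, §1.2.2 (1) (p. 4)] -/
theorem umbrellaAddPowIn_eq_umbrellaPow : umbrellaAddPowIn k i j l e q = umbrellaPow k i j l e q := by
  rw [umbrellaAddPowIn, umbrellaPow_eq]

/-- The germ is non-zero (plumbing). [folklore] -/
private theorem umbrellaPow_ne_zero (hij : i ≠ j) (hil : i ≠ l) (hie : i ≠ e) (hq : q ≠ 0) :
    umbrellaPow k i j l e q ≠ 0 := by
  intro h0
  have := congrArg (aeval (Pi.single i (1 : k))) h0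
  rw [umbrellaPow_eq] at this
  simp [Ne.symm hij, Ne.symm hil, Ne.symm hie, zero_pow hq] at this

/-- **Shape of `max W(X_i² + X_j² X_l + X_e^q)`** (`q ≥ 4` invertible in `k`, `i, j, l, e` distinct, spectators
allowed, ALL polynomial coordinate changes): every `TruncLex`-maximal element of `W(f)` is `(2, 3, 3, c, …)` with
`c ≥ q`.  (The census value is `(2,3,3,q)`; `c ≤ q` is open in the model.) (derived here: first face + second
face + `[] ∉ W`) [cite: AbramovichTemkinWlodarczyk2024, Thm. 5.3.1 (2) (p. 1578) (inv = max W)] -/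
theorem isMaxInv_umbrellaPow_shape (hij : i ≠ j) (hil : i ≠ l) (hie : i ≠ e) (hjl : j ≠ l) (hje : j ≠ e)
    (hle : l ≠ e) (hqk : (q : k) ≠ 0) (hq : 4 ≤ q) {a : List ℚ}
    (ha : IsMaxInv (admissibleInvariants (umbrellaPow k i j l e q)) a) :
    ∃ (c : ℚ) (rest : List ℚ), a = 2 :: 3 :: 3 :: c :: rest ∧ (q : ℚ) ≤ c := by
  have hW := ha.1
  have hup : ¬ ATW.TruncLex.lt [(2 : ℚ), 3, 3] a :=
    not_lt_of_mem_admissibleInvariants_umbrellaPow hij hil hie hjl hle hq hW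
  have hdown : ¬ ATW.TruncLex.lt a [(2 : ℚ), 3, 3, (q : ℚ)] :=
    ha.2 _ (umbrellaPow_inv_mem hij hil hie hjl hje hle (by omega))
  have hsf := not_mem_admissibleInvariants_umbrellaAddPowIn_of_ne_zero (k := k) hij hil hie hjl hje hle hqk
    (by omega)
  rw [umbrellaAddPowIn_eq_umbrellaPow] at hsf
  rcases a with _ | ⟨a₁, t⟩
  · exact absurd hW (nil_not_mem_admissibleInvariants (umbrellaPow_ne_zero hij hil hie (by omega)))
  rw [ATW.TruncLex.cons_lt_cons] at hup hdown
  push Not at hup hdown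
  have ha₁ : a₁ = 2 := le_antisymm hup.1 hdown.1
  subst ha₁
  have hup₂ := hup.2 rfl
  have hdown₂ := hdown.2 rfl
  rcases t with _ | ⟨a₂, t₂⟩
  · exact absurd hW hsf.2.2
  rw [ATW.TruncLex.cons_lt_cons] at hup₂ hdown₂
  push Not at hup₂ hdown₂
  have ha₂ : a₂ = 3 := le_antisymm hup₂.1 hdown₂.1
  subst ha₂
  have hup₃ := hup₂.2 rfl
  have hdown₃ := hdown₂.2 rfl
  rcases t₂ with _ | ⟨a₃, t₃⟩
  · exact absurd hW hsf.2.1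
  rw [ATW.TruncLex.cons_lt_cons] at hup₃ hdown₃
  push Not at hup₃ hdown₃
  have ha₃ : a₃ = 3 := le_antisymm hup₃.1 hdown₃.1
  subst ha₃
  have hdown₄ := hdown₃.2 rfl
  rcases t₃ with _ | ⟨c, rest⟩
  · exact absurd hW hsf.1
  rw [ATW.TruncLex.cons_lt_cons] at hdown₄
  push Not at hdown₄
  exact ⟨c, rest, rfl, hdown₄.1⟩

end Literature.AlgebraicGeometry.Resolution.WeightedBlowup
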